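import Summits.BirchSwinnertonDyer.BirchSwinnertonDyer.Theorems.EisensteinPrimesBSDpOnCellCReorientedDatum
import Summits.BirchSwinnertonDyer.BirchSwinnertonDyer.Theorems.EisensteinPrimesBSDpOnCellCCtlSplitClass
import Summits.BirchSwinnertonDyer.Rank1Residual.X2.SplitCellCClassIntPNew
import HarnessLib

/-!
# Crux 4 `BSDpOnCellC` (stmt-BirchSwinnertonDyer-19034), line b1: the `p ≥ 5` roads (value half FROM PRINT,
# [cas-split] Thms. 2.10–2.11) RE-THREADED on the RE-ORIENTED IMC atoms c3♭′ / c3s♭′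
# (`X2.NonsplitIMCEqOnTreeIntOther`, `X2.SplitIMCEqOnTreeIntOther`; X-slot at `𝔭̄`, frames at `(ι′, 𝔭)`
# — RULING L31 (R1)), pointwise with a Manin datum prime to `p`, BOTH signs (cell `bsd-eis`, seat
# `bsd-eis-cgshw` g12)

HONEST FRAMING (cell `bsd-eis`, run/shared/lean/pub/bsd-eis/): theorems only; nothing booked; X2 stays
CONSTRUCTION-SHAPED; no label or count moves; BSD is not proved by any of this. Every theorem is
CONDITIONAL on its displayed binders — in particular on the re-oriented IMC atom (Keller–Yin Thm. D shape,
PREPRINT with the L1754 gap) and on the two named analytic facts (Hsieh 2014 Thm. 1 `hH`, PUB;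
[cas-split] `hCS`, PUB `p ≥ 5`).

k5-c4's `X2.bsdp_of_cellC_of_not_split_of_manin_of_pNewValue_of_imcInt_of_partner`
(`X2/NonsplitCellCClassIntPNew.lean`) and cgshw g9's `X2.bsdp_of_cellC_of_split_of_manin_of_pNewValue_of_imcInt_of_ctl`
(`X2/SplitCellCClassIntPNew.lean`) VERBATIM up to three steps: (i) the OTHER degree-one prime `𝔭̄` is
produced (`X11b.LocalIndexTransport.exists_conj_prime_of_splitsIn`, `X11b.degreeOne_of_splitsIn`); (ii)
the IMC atom is instantiated with the X-slot at `𝔭̄` (it asks `Odd (discr K)`, which the produced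
Hoffstein–Luo field has); (iii) the two ♭ atoms at Hsieh's frame give (IMC∘BDP)@`𝟙` at
`(𝔭̄, embAt K p 𝔭̄)` by `Theorems.LogSymmetry.imcWaldspurgerOnTreeAt_other_of_intHalves_…` and the
shadow-link road concludes AT `𝔭̄`. The printed VALUE (logarithm at `𝔭`, the frame's prime) is used
unchanged. On the split side CTL-split is the THEOREM `Theorems.CtlLoc.splitControlOnTree_of_cellC`
(k5-c4 g5, p484252), so the theorem carries the five cited cohomological facts instead of a «CTL ∨ switch»
input.

References: [Castella2018Exceptional] Thms. 2.10–2.11, Prop. 2.7; [Castella2018] Thm. 2.3, Thm. 3.2, §5;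
[Hsieh2014] Thm. 1; [BertoliniDarmonPrasanna2013] §5.2; [KellerYin2024] Thm. D (PRE); [CastellaEtAl2021]
Thm. 5.3.1; [Miller2011LMS] Def. 1.1; RULING L31; cell memos c3h MEMO-2, k5-c4 MEMO-1/3.
-/

set_option autoImplicit false
set_option linter.dupNamespace false

noncomputable section

open scoped Classical MatrixGroups ModularForm Topology

open Filter CongruenceSubgroup WeierstrassCurve NumberField IsDedekindDomain Field PowerSeries
  Literature.NumberTheory.EllipticCurves Literature.NumberTheory.EllipticCurves.GreenbergSelmer
  Literature.NumberTheory.EllipticCurves.ModularForms Literature.NumberTheory.QuadraticFields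
  Literature.NumberTheory.EllipticCurves.Rank1Residual
  Literature.NumberTheory.EllipticCurves.Rank1Residual.Typed
  Literature.NumberTheory.EllipticCurves.KrizLi2019
  Literature.NumberTheory.EllipticCurves.GreenbergVatsal2000
  Literature.NumberTheory.EllipticCurves.Wuthrich2014
  Literature.NumberTheory.EllipticCurves.SteinWuthrich2013
  Literature.NumberTheory.EllipticCurves.Castella2018
  Literature.NumberTheory.EllipticCurves.Castella2018Exceptional
  Literature.NumberTheory.GaloisRepresentations Literature.NumberTheory.GaloisCohomology
  Literature.NumberTheory.Automorphic
  Summit.BirchSwinnertonDyer.Rank1Residual.X11b.AcSelmer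
  Summit.BirchSwinnertonDyer.Rank1Residual.X11b.Halves
  Summit.BirchSwinnertonDyer.Rank1Residual.X11b
  Summit.BirchSwinnertonDyer.Rank1Residual.X2
  Summit.BirchSwinnertonDyer.Rank1Residual

namespace Summit.BirchSwinnertonDyer.BirchSwinnertonDyer.Theorems.Reoriented

variable (W : WeierstrassCurve ℚ) [W.IsElliptic] [W.IsGloballyMinimal] (p : ℕ) [Fact p.Prime]

/-- **X2c ∩ {non-split}, `p ≥ 5`, pointwise with a Manin datum, partner-supply form — c2 FROM PRINT, IMC
atom RE-ORIENTED** (`h3 : X2.NonsplitIMCEqOnTreeIntOther W p`). k5-c4's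
`X2.bsdp_of_cellC_of_not_split_of_manin_of_pNewValue_of_imcInt_of_partner` verbatim up to the three steps
of the module docstring (the other prime `𝔭̄`; c3♭′ at `𝔭̄` using `Odd (d_K)`; the composite and the
shadow-link road at `𝔭̄` via `LogSymmetry.imcWaldspurgerOnTreeAt_other_of_intHalves_of_not_split_of_rankOne`).
CONDITIONAL on every listed binder; nothing booked. [cite: Castella2018Exceptional, Thm. 2.10 and Thm. 2.11 (arXiv:1507.04260 pp. 13–14)]
[cite: Hsieh2014, Thm. 1 (arXiv:1112.1580 pp. 3–4)] [claim: KellerYin2024, status: under-review]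
[cite: CastellaEtAl2021, Thm. 5.3.1 and (5.5)–(5.7)] [cite: Miller2011LMS, Def. 1.1] -/
theorem bsdp_of_cellC_of_not_split_of_manin_of_pNewValue_of_imcIntOther_of_partner
    (hnf : exists_isNewformOf)
    (hPT : ∀ (K : Type) [Field K] [NumberField K], poitouTate_selmerStructure_duality K)
    (hPT2 : ∀ (K : Type) [Field K] [NumberField K], poitouTate_sha_tateDual K)
    (hEP : ∀ (K : Type) [Field K] [NumberField K] (v : HeightOneSpectrum (𝓞 K)),
      localEulerPoincareCharacteristic (v.adicCompletion K))
    (hcd : fieldCdLE_two_of_numberField)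
    (hBr : ∀ (K : Type) [Field K] [NumberField K] (p : ℕ) [Fact p.Prime],
      ZpExtension.decomp_not_le_kerSubgroup_of_isAnticyclotomic K p)
    (hH : hsieh2014_exists_anticyclotomicPAdicLFunction)
    (hCS : thm210_thm211_bdpDisplay_pNew)
    (hGZ : ∀ (N : ℕ) [NeZero N] (W : WeierstrassCurve ℚ) (K : Type) [Field K] [NumberField K],
      gross_zagier N W K)
    (hKo : ∀ (N : ℕ) [NeZero N] (W : WeierstrassCurve ℚ) (K : Type) [Field K] [NumberField K],
      kolyvagin N W K)
    (hHP : ∀ (N : ℕ) [NeZero N] (W : WeierstrassCurve ℚ) (K : Type) [Field K] [NumberField K],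
      heegnerPointComplex_mem_range_map N W K)
    (hGZK : rank_eq_analyticRank_of_analyticRank_le_one)
    (hHL : HoffsteinLuo1997_exists_twist_L_one_ne_zero)
    (hp5 : 5 ≤ p) (hc : CellC W p) (hns : ¬ W.HasSplitMultiplicativeReductionAtPrime p)
    (hMan : HasPrimeToManinDatum W p) (h3 : NonsplitIMCEqOnTreeIntOther W p)
    (hpartner : ∀ (K : Type) [Field K] [NumberField K], IsImaginaryQuadratic K →
        Odd (NumberField.discr K) → NumberField.discr K < -4 →
        SatisfiesHeegnerHypothesis (W.conductorNorm ℤ) K → SatisfiesHeegnerHypothesis p K →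
        (W.quadraticTwist (NumberField.discr K : ℚ)).entireLFunction 1 ≠ 0 →
      ∀ (Wd : WeierstrassCurve ℚ) [Wd.IsElliptic] [Wd.IsGloballyMinimal],
        (∃ C : VariableChange ℚ, C • Wd = W.quadraticTwist (NumberField.discr K : ℚ)) →
        Wd.analyticRank = 0 → PPartRankZero Wd p) :
    BSDp W p := by
  have hp : p.Prime := Fact.out
  have hmod : hasEntireLFunction_rat := WeierstrassCurve.hasEntireLFunction_rat_of_exists_isNewformOf hnf
  obtain ⟨hr, hp2, hred, hmult⟩ := hc
  haveI : NeZero (W.conductorNorm ℤ) := ⟨(W.conductorNorm_pos_holds).ne'⟩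
  -- `w(E) = -1`
  have hw : W.rootNumber = -1 := by
    rw [WeierstrassCurve.rootNumber_eq_neg_one_pow_analyticRank_of_exists_isNewformOf hnf W, hr]
    norm_num
  -- the admissible auxiliary field (odd `d_K < -4`, Heegner for `N_E`, `L(E^{d_K},1) ≠ 0`)
  obtain ⟨K, _, _, hK, hodd, hlt, hHN, hHp, hLK⟩ :=
    exists_admissibleField_of_rootNumber_eq_neg_one hnf hHL W hw p
  have hsp : SplitsIn K p := hHp p hp dvd_rfl
  -- the datum with `p ∤ c`, a Heegner datum and the `K`-rational Heegner point READ THROUGH `w₀`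
  obtain ⟨Dt, hcM⟩ := hMan
  obtain ⟨β, hβ⟩ := exists_dvd_sq_sub_discr_holds (W.conductorNorm ℤ) K hK hHN
  obtain ⟨H, -⟩ := nonempty_heegnerDatum_holds (W.conductorNorm ℤ) K hK hβ
  obtain ⟨w₀⟩ := (inferInstance : Nonempty (InfinitePlace K))
  obtain ⟨P, hP⟩ := hHP (W.conductorNorm ℤ) W K hK hHN Dt H w₀.embedding
  -- the Heegner point has infinite order: `L'(E/K,1) = L'(E,1)·L(E^K,1) ≠ 0` (Gross–Zagier)
  have hL0 : W.entireLFunction 1 = 0 := entireLFunction_one_eq_zero_of_analyticRank_eq_one hr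
  obtain ⟨-, hderiv⟩ := leadingLCoeff_eq_deriv_of_analyticRank_eq_one hr
  have hLKd : LDerivEK W K ≠ 0 := by
    rw [lDerivEK_eq_deriv_mul W K hmod hL0]
    exact mul_ne_zero hderiv hLK
  have hPH : IsHeegnerPoint (W.conductorNorm ℤ) W K P := ⟨Dt, H, w₀.embedding, hP⟩
  have hPinf : ¬ IsOfFinAddOrder P :=
    (lDerivEK_ne_zero_iff_not_isOfFinAddOrder W (W.conductorNorm ℤ) K (hGZ _ W K) hK hHN hPH).mp hLKd
  -- a globally minimal model of the twist (Néron) and its transport values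
  have hD0 : (NumberField.discr K : ℚ) ≠ 0 := by exact_mod_cast NumberField.discr_ne_zero K
  haveI hEt : (W.quadraticTwist (NumberField.discr K : ℚ)).IsElliptic :=
    W.isElliptic_quadraticTwist hD0
  obtain ⟨Cd, hCd⟩ := hasGlobalMinimalModel_rat_holds (W.quadraticTwist (NumberField.discr K : ℚ))
  set Wd : WeierstrassCurve ℚ := Cd • W.quadraticTwist (NumberField.discr K : ℚ) with hWd_def
  haveI : Wd.IsGloballyMinimal := hCd
  have hWd : Cd • W.quadraticTwist (NumberField.discr K : ℚ) = Wd := rfl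
  have hC : Cd⁻¹ • Wd = W.quadraticTwist (NumberField.discr K : ℚ) := by
    rw [← hWd, inv_smul_smul]
  obtain ⟨htam, hu⟩ := twistTransportPackage_holds W p K Wd Cd ⟨hr, hp2, hred, hmult⟩ hK hodd hHN hWd
  have htamK : padicValNat p (W.baseChange K).tamagawaProduct = 2 * padicValNat p W.tamagawaProduct :=
    padicValNat_tamagawaProduct_baseChange_of_heegner_odd W p hp2 K hK hodd hHN hHp
  -- the twist has analytic rank `0`; its rank-zero `p`-part from the supply
  have hLd : Wd.entireLFunction 1 ≠ 0 := by
    rw [← hWd, entireLFunction_smul]; exact hLK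
  have hrd : Wd.analyticRank = 0 := (Wd.analyticRank_eq_zero_iff_holds (hmod _)).2 hLd
  have htw : PPartRankZero Wd p := hpartner K hK hodd hlt hHN hHp hLK Wd ⟨Cd⁻¹, hC⟩ hrd
  -- the anticyclotomic `ℤ_p`-extension, a topological generator, the two degree-one primes above `p`
  haveI : IsTotallyComplex K := hK.2
  obtain ⟨κ, hκ⟩ := ZpExtension.exists_isAnticyclotomic_holds (K := K) (p := p) hK.1
    (fun w ↦ IsTotallyComplex.isComplex w)
  obtain ⟨γ, hγ⟩ := κ.surjective (Multiplicative.ofAdd 1)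
  haveI : Fact (κ.IsTopGenerator γ) := ⟨hγ⟩
  have hpN : p ∣ W.conductorNorm ℤ := X11b.dvd_conductorNorm_of_mult (W := W) hmult
  have hp2N : ¬ p ^ 2 ∣ W.conductorNorm ℤ := X2.not_sq_dvd_conductorNorm_of_mult W p hmult
  obtain ⟨𝔭, h𝔭, he, hf⟩ := X11b.exists_degreeOnePrime_of_splitsIn K p hK.1 hsp
  obtain ⟨-, 𝔭bar, -, hne, h𝔭bar, -⟩ := LocalIndexTransport.exists_conj_prime_of_splitsIn K p hK.1 hsp h𝔭
  obtain ⟨hebar, hfbar⟩ := degreeOne_of_splitsIn hK.1 hsp h𝔭bar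
  -- an embedding datum inducing `𝔭`, Hsieh's ♭-frame there (for the newform `Dt.f`), c3♭′ at it
  obtain ⟨ι₀⟩ := PadicAlgCl.nonempty_ringEquiv_complex p
  obtain ⟨ι', -, hι'⟩ := X11b.exists_datum_forall_mem_iff p ι₀ hK h𝔭
  obtain ⟨ΩK', Ωp', Q, hΩK', hΩp', hQ⟩ := exists_isBDPLFunctionInt_of_hsieh2014_of_classX2 W p hH ι' 𝔭
    κ γ Dt.isNewformOf ⟨hp2, hred, hmult⟩ rfl hK hHN h𝔭 hι' hκ hγ
  have hΩp0' : Ωp' ≠ 0 := fun h0 ↦ by rw [h0, norm_zero] at hΩp'; exact zero_ne_one hΩp'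
  have h3Q : R1.IMCEqIntAt W p κ 𝔭bar γ Q :=
    h3 (W.conductorNorm ℤ) K Dt H w₀.embedding P ⟨hr, hp2, hred, hmult⟩ hns rfl hK hlt hHN hLK hP
      hcM hPinf hodd κ hκ γ 𝔭 h𝔭 he hf 𝔭bar h𝔭bar hne hsp Dt.f Dt.isNewformOf ι' hι' ΩK' Ωp' Q hΩK'
      hΩp' hQ
  -- the value at `𝟙` of `Q` from print (logarithm at `𝔭`): continuity display + one-sided rigidity
  have hemb : ∀ k : 𝓞 K, k ∈ 𝔭.asIdeal ↔ ‖embAt K p 𝔭 h𝔭 he hf (k : K)‖ < 1 :=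
    mem_asIdeal_iff_norm_embAt_lt_one 𝔭 h𝔭 he hf
  obtain ⟨ΩK₀, Ωp₀, u₀, hΩK₀, hΩp₀, hu₀, hcont⟩ := continuousDisplay_pNew_of_bdpDisplay hCS ι' W K 𝔭 κ γ
    Dt H w₀ (embAt K p 𝔭 h𝔭 he hf)
    P hp5 rfl hpN hp2N hK hodd (hHN p hp hpN) h𝔭 hι' hHN hκ hγ hcM hP hemb
  have ha : ¬ (p : ℤ) ∣ W.LFunction p := X11b.R1.not_dvd_lFunction_of_mult Dt.isNewformOf hmult
  have hX : algebraMap ℚ_[p] ℂ_[p] (((1 : ℚ_[p]) - ((W.LFunction p : ℤ) : ℚ_[p]) * (p : ℚ_[p])⁻¹) *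
      padicLogOmega W p (embAt K p 𝔭 h𝔭 he hf) P) ≠ 0 := by
    rw [map_ne_zero_iff _ (algebraMap ℚ_[p] ℂ_[p]).injective]
    refine mul_ne_zero ?_ ?_
    · intro h0
      have h := X11b.R1.norm_one_sub_div_eq p ha
      rw [h0, norm_zero] at h
      have hp0 : (0 : ℝ) < p := by exact_mod_cast hp.pos
      exact absurd h (ne_of_lt hp0)
    · rw [← X11b.R1.logOmega_eq_padicLogOmega]
      exact X11b.R1.logOmega_ne_zero W p _ hPinf
  have hu₀0 : u₀ ≠ 0 := fun h0 ↦ by rw [h0, norm_zero] at hu₀; exact zero_ne_one hu₀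
  have hc0 : u₀ * (algebraMap ℚ_[p] ℂ_[p] (((1 : ℚ_[p]) - ((W.LFunction p : ℤ) : ℚ_[p]) *
      (p : ℚ_[p])⁻¹) * padicLogOmega W p (embAt K p 𝔭 h𝔭 he hf) P)) ^ 2 ≠ 0 :=
    mul_ne_zero hu₀0 (pow_ne_zero _ hX)
  have heq := X11b.intSeries_constantCoeff_eq_of_isBDPLFunctionInt_of_continuousValues hp2 hK hκ hγ
    hΩK₀ hΩK' hΩp₀ hΩp0' hcont hc0 hQ
  have h2Q : R1.BDPValueAtOneIntAt W p (embAt K p 𝔭 h𝔭 he hf) P Q (W.LFunction p) := by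
    refine ⟨u₀, hu₀, ?_⟩
    rw [X11b.R1.logOmega_eq_padicLogOmega, ← heq]
    exact X11b.R1.intSeries_hasValueAt_zero p Q
  -- the composite at `(𝔭̄, embAt 𝔭̄)` from the ♭ atoms at `Q`, then the (b1) road's links at `𝔭̄`
  have hIW := LogSymmetry.imcWaldspurgerOnTreeAt_other_of_intHalves_of_not_split_of_rankOne W p hGZK
    hnf hPT hPT2 hEP hcd hBr hp2 hmult hns hr hK hsp hLK P hPinf κ hκ γ 𝔭 𝔭bar h𝔭 he hf h𝔭bar hebar
    hfbar Q h3Q h2Q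
  exact bsdp_of_cellC_of_not_split_of_imcWaldspurgerOnTree_of_partner hnf hPT hPT2 hEP hcd hBr W p
    (W.conductorNorm ℤ) K Dt H w₀.embedding P (hGZ _ W K) (hKo _ W K) hGZK ⟨hr, hp2, hred, hmult⟩ hns
    rfl hK hlt hHN hHp hP hPinf hcM hLK Wd Cd hWd htw htam hu htamK κ hκ γ 𝔭bar h𝔭bar hebar hfbar hIW

/-- **X2c ∩ {SPLIT}, `p ≥ 5`, pointwise with a Manin datum — c2s FROM PRINT, IMC atom RE-ORIENTED
(`h3 : X2.SplitIMCEqOnTreeIntOther W p`), CTL-split the THEOREM `Theorems.CtlLoc.splitControlOnTree_of_cellC`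
(k5-c4 g5, p484252), the partner's rank-zero `p`-part by parity cases** (`hMCB` = Mazur's MC on
X2b ∩ {split}). cgshw g9's `X2.bsdp_of_cellC_of_split_of_manin_of_pNewValue_of_imcInt_of_ctl` verbatim up
to the three steps of the module docstring; the conclusion is by the shadow links at
`(𝔭̄, embAt K p 𝔭̄)` (`X11b.exists_shadowLinks_of_onTree_of_heegner`) and `X2.bsdp_of_cellC_of_indexIdentityAt`.
CONDITIONAL on every listed binder; nothing booked. [cite: Castella2018Exceptional, Thm. 2.10 and Thm. 2.11 (arXiv:1507.04260 pp. 13–14)]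
[cite: Hsieh2014, Thm. 1 (arXiv:1112.1580 pp. 3–4)] [claim: KellerYin2024, status: under-review]
[cite: Castella2018, Thm. 2.3 and §5 (5.1)–(5.3) (arXiv:1704.06608 pp. 5, 12)]
[cite: CastellaEtAl2021, Thm. 5.3.1 and (5.5)–(5.7)] [cite: Miller2011LMS, Def. 1.1] -/
theorem bsdp_of_cellC_of_split_of_manin_of_pNewValue_of_imcIntOther
    (hGV : lambdaMu_multiplicative_of_gvPar) (hWu : thm16_charIdeal_dvd_multiplicative_of_reducible)
    (hJs : thm61_splitMultiplicative) (hJn : thm61_nonsplitMultiplicative)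
    (hHs : exists_isSplitMultCanonical) (hHn : exists_isMultCanonical)
    (hpar : nonempty_modularParametrizationData)
    (hGS : ∀ (W : WeierstrassCurve ℚ) [W.IsElliptic] [W.IsGloballyMinimal] (p : ℕ) [Fact p.Prime],
      greenberg_stevens (W := W) (p := p))
    (hnf : exists_isNewformOf)
    (hPT : ∀ (K : Type) [Field K] [NumberField K], poitouTate_selmerStructure_duality K)
    (hPT2 : ∀ (K : Type) [Field K] [NumberField K], poitouTate_sha_tateDual K)
    (hEP : ∀ (K : Type) [Field K] [NumberField K] (v : HeightOneSpectrum (𝓞 K)),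
      localEulerPoincareCharacteristic (v.adicCompletion K))
    (hBr : ∀ (K : Type) [Field K] [NumberField K] (p : ℕ) [Fact p.Prime],
      ZpExtension.decomp_not_le_kerSubgroup_of_isAnticyclotomic K p)
    (hH : hsieh2014_exists_anticyclotomicPAdicLFunction)
    (hCS : thm210_thm211_bdpDisplay_pNew)
    (hGZ : ∀ (N : ℕ) [NeZero N] (W : WeierstrassCurve ℚ) (K : Type) [Field K] [NumberField K],
      gross_zagier N W K)
    (hKo : ∀ (N : ℕ) [NeZero N] (W : WeierstrassCurve ℚ) (K : Type) [Field K] [NumberField K],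
      kolyvagin N W K)
    (hHP : ∀ (N : ℕ) [NeZero N] (W : WeierstrassCurve ℚ) (K : Type) [Field K] [NumberField K],
      heegnerPointComplex_mem_range_map N W K)
    (hGZK : rank_eq_analyticRank_of_analyticRank_le_one)
    (hHL : HoffsteinLuo1997_exists_twist_L_one_ne_zero)
    (hp5 : 5 ≤ p) (hc : CellC W p) (hs : W.HasSplitMultiplicativeReductionAtPrime p)
    (hMan : HasPrimeToManinDatum W p) (h3 : SplitIMCEqOnTreeIntOther W p)
    (hMCB : ∀ (W' : WeierstrassCurve ℚ) [W'.IsElliptic] [W'.IsGloballyMinimal],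
      CellB W' p → W'.HasSplitMultiplicativeReductionAtPrime p → MazurMainConjectureAt W' p) :
    BSDp W p := by
  have hp : p.Prime := Fact.out
  have hmod : hasEntireLFunction_rat := WeierstrassCurve.hasEntireLFunction_rat_of_exists_isNewformOf hnf
  have hCTL : SplitControlOnTree W p :=
    CtlLoc.splitControlOnTree_of_cellC W p hGZK hnf hPT hPT2 hEP hBr hc hs
  obtain ⟨hr, hp2, hred, hmult⟩ := hc
  haveI : NeZero (W.conductorNorm ℤ) := ⟨(W.conductorNorm_pos_holds).ne'⟩
  -- `w(E) = -1`
  have hw : W.rootNumber = -1 := by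
    rw [WeierstrassCurve.rootNumber_eq_neg_one_pow_analyticRank_of_exists_isNewformOf hnf W, hr]
    norm_num
  -- the admissible auxiliary field (odd `d_K < -4`, Heegner for `N_E`, `L(E^{d_K},1) ≠ 0`)
  obtain ⟨K, _, _, hK, hodd, hlt, hHN, hHp, hLK⟩ :=
    exists_admissibleField_of_rootNumber_eq_neg_one hnf hHL W hw p
  have hsp : SplitsIn K p := hHp p hp dvd_rfl
  -- the datum with `p ∤ c`, a Heegner datum and the `K`-rational Heegner point READ THROUGH `w₀`
  obtain ⟨Dt, hcM⟩ := hMan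
  obtain ⟨β, hβ⟩ := exists_dvd_sq_sub_discr_holds (W.conductorNorm ℤ) K hK hHN
  obtain ⟨H, -⟩ := nonempty_heegnerDatum_holds (W.conductorNorm ℤ) K hK hβ
  obtain ⟨w₀⟩ := (inferInstance : Nonempty (InfinitePlace K))
  obtain ⟨P, hP⟩ := hHP (W.conductorNorm ℤ) W K hK hHN Dt H w₀.embedding
  -- the Heegner point has infinite order (Gross–Zagier)
  have hL0 : W.entireLFunction 1 = 0 := entireLFunction_one_eq_zero_of_analyticRank_eq_one hr
  obtain ⟨-, hderiv⟩ := leadingLCoeff_eq_deriv_of_analyticRank_eq_one hr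
  have hLKd : LDerivEK W K ≠ 0 := by
    rw [lDerivEK_eq_deriv_mul W K hmod hL0]
    exact mul_ne_zero hderiv hLK
  have hPH : IsHeegnerPoint (W.conductorNorm ℤ) W K P := ⟨Dt, H, w₀.embedding, hP⟩
  have hPinf : ¬ IsOfFinAddOrder P :=
    (lDerivEK_ne_zero_iff_not_isOfFinAddOrder W (W.conductorNorm ℤ) K (hGZ _ W K) hK hHN hPH).mp hLKd
  -- a globally minimal model of the twist (Néron) and its transport values
  have hD0 : (NumberField.discr K : ℚ) ≠ 0 := by exact_mod_cast NumberField.discr_ne_zero K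
  haveI hEt : (W.quadraticTwist (NumberField.discr K : ℚ)).IsElliptic :=
    W.isElliptic_quadraticTwist hD0
  obtain ⟨Cd, hCd⟩ := hasGlobalMinimalModel_rat_holds (W.quadraticTwist (NumberField.discr K : ℚ))
  set Wd : WeierstrassCurve ℚ := Cd • W.quadraticTwist (NumberField.discr K : ℚ) with hWd_def
  haveI : Wd.IsGloballyMinimal := hCd
  have hWd : Cd • W.quadraticTwist (NumberField.discr K : ℚ) = Wd := rfl
  have hC : Cd⁻¹ • Wd = W.quadraticTwist (NumberField.discr K : ℚ) := by
    rw [← hWd, inv_smul_smul]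
  obtain ⟨htam, hu⟩ := twistTransportPackage_holds W p K Wd Cd ⟨hr, hp2, hred, hmult⟩ hK hodd hHN hWd
  have htamK : padicValNat p (W.baseChange K).tamagawaProduct = 2 * padicValNat p W.tamagawaProduct :=
    padicValNat_tamagawaProduct_baseChange_of_heegner_odd W p hp2 K hK hodd hHN hHp
  -- the twist: analytic rank `0`, X2, SPLIT at `p`; its rank-zero `p`-part by parity cases
  have hLd : Wd.entireLFunction 1 ≠ 0 := by
    rw [← hWd, entireLFunction_smul]; exact hLK
  have hrd : Wd.analyticRank = 0 := (Wd.analyticRank_eq_zero_iff_holds (hmod _)).2 hLd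
  have hXd : ClassX2 Wd p := classX2_twist W p ⟨hp2, hred, hmult⟩ K hK hHp Wd ⟨Cd⁻¹, hC⟩
  have hsd : Wd.HasSplitMultiplicativeReductionAtPrime p :=
    (hasSplitMultiplicativeReductionAtPrime_iff_of_smul_eq_quadraticTwist W Wd hK p hp2 hmult hHp
      hC).mpr hs
  have hbsdd : BSDp Wd p := by
    by_cases hgv : GVPar Wd p
    · exact targetA_of_published hGV hWu hJs hJn hHs hHn hGZK hmod hpar hGS Wd p ⟨hrd, hXd, hgv⟩
    · exact bsdp_of_mazurMainConjectureAt_of_analyticRank_eq_zero hJs hJn hHs hHn hGZK hmod hpar Wd p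
        (hGS Wd p) hXd.1 hXd.2.2 hrd (hMCB Wd ⟨hrd, hXd, hgv⟩ hsd)
  have htw : PPartRankZero Wd p :=
    pPartRankZero_of_pPart hGZK Wd p hrd (pPart_of_bsdp hmod hGZK Wd p (by omega) hbsdd)
  -- the anticyclotomic `ℤ_p`-extension, a topological generator, the two degree-one primes above `p`
  haveI : IsTotallyComplex K := hK.2
  obtain ⟨κ, hκ⟩ := ZpExtension.exists_isAnticyclotomic_holds (K := K) (p := p) hK.1
    (fun w ↦ IsTotallyComplex.isComplex w)
  obtain ⟨γ, hγ⟩ := κ.surjective (Multiplicative.ofAdd 1)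
  haveI : Fact (κ.IsTopGenerator γ) := ⟨hγ⟩
  have hpN : p ∣ W.conductorNorm ℤ := X11b.dvd_conductorNorm_of_mult (W := W) hmult
  have hp2N : ¬ p ^ 2 ∣ W.conductorNorm ℤ := X2.not_sq_dvd_conductorNorm_of_mult W p hmult
  obtain ⟨𝔭, h𝔭, he, hf⟩ := X11b.exists_degreeOnePrime_of_splitsIn K p hK.1 hsp
  obtain ⟨-, 𝔭bar, -, hne, h𝔭bar, -⟩ := LocalIndexTransport.exists_conj_prime_of_splitsIn K p hK.1 hsp h𝔭
  obtain ⟨hebar, hfbar⟩ := degreeOne_of_splitsIn hK.1 hsp h𝔭bar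
  -- an embedding datum inducing `𝔭`, Hsieh's ♭-frame there (for the newform `Dt.f`), c3s♭′ at it
  obtain ⟨ι₀⟩ := PadicAlgCl.nonempty_ringEquiv_complex p
  obtain ⟨ι', -, hι'⟩ := X11b.exists_datum_forall_mem_iff p ι₀ hK h𝔭
  obtain ⟨ΩK', Ωp', Q, hΩK', hΩp', hQ⟩ := exists_isBDPLFunctionInt_of_hsieh2014_of_classX2 W p hH ι' 𝔭
    κ γ Dt.isNewformOf ⟨hp2, hred, hmult⟩ rfl hK hHN h𝔭 hι' hκ hγ
  have hΩp0' : Ωp' ≠ 0 := fun h0 ↦ by rw [h0, norm_zero] at hΩp'; exact zero_ne_one hΩp'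
  have h3Q : R1.IMCEqIntAt W p κ 𝔭bar γ Q :=
    h3 (W.conductorNorm ℤ) K Dt H w₀.embedding P ⟨hr, hp2, hred, hmult⟩ hs rfl hK hlt hHN hLK hP
      hcM hPinf hodd κ hκ γ 𝔭 h𝔭 he hf 𝔭bar h𝔭bar hne hsp Dt.f Dt.isNewformOf ι' hι' ΩK' Ωp' Q hΩK'
      hΩp' hQ
  -- the value at `𝟙` of `Q` from print (logarithm at `𝔭`): continuity display + one-sided rigidity
  have hemb : ∀ k : 𝓞 K, k ∈ 𝔭.asIdeal ↔ ‖embAt K p 𝔭 h𝔭 he hf (k : K)‖ < 1 :=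
    mem_asIdeal_iff_norm_embAt_lt_one 𝔭 h𝔭 he hf
  obtain ⟨ΩK₀, Ωp₀, u₀, hΩK₀, hΩp₀, hu₀, hcont⟩ := continuousDisplay_pNew_of_bdpDisplay hCS ι' W K 𝔭 κ γ
    Dt H w₀ (embAt K p 𝔭 h𝔭 he hf)
    P hp5 rfl hpN hp2N hK hodd (hHN p hp hpN) h𝔭 hι' hHN hκ hγ hcM hP hemb
  have ha : ¬ (p : ℤ) ∣ W.LFunction p := X11b.R1.not_dvd_lFunction_of_mult Dt.isNewformOf hmult
  have hX : algebraMap ℚ_[p] ℂ_[p] (((1 : ℚ_[p]) - ((W.LFunction p : ℤ) : ℚ_[p]) * (p : ℚ_[p])⁻¹) *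
      padicLogOmega W p (embAt K p 𝔭 h𝔭 he hf) P) ≠ 0 := by
    rw [map_ne_zero_iff _ (algebraMap ℚ_[p] ℂ_[p]).injective]
    refine mul_ne_zero ?_ ?_
    · intro h0
      have h := X11b.R1.norm_one_sub_div_eq p ha
      rw [h0, norm_zero] at h
      have hp0 : (0 : ℝ) < p := by exact_mod_cast hp.pos
      exact absurd h (ne_of_lt hp0)
    · rw [← X11b.R1.logOmega_eq_padicLogOmega]
      exact X11b.R1.logOmega_ne_zero W p _ hPinf
  have hu₀0 : u₀ ≠ 0 := fun h0 ↦ by rw [h0, norm_zero] at hu₀; exact zero_ne_one hu₀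
  have hc0 : u₀ * (algebraMap ℚ_[p] ℂ_[p] (((1 : ℚ_[p]) - ((W.LFunction p : ℤ) : ℚ_[p]) *
      (p : ℚ_[p])⁻¹) * padicLogOmega W p (embAt K p 𝔭 h𝔭 he hf) P)) ^ 2 ≠ 0 :=
    mul_ne_zero hu₀0 (pow_ne_zero _ hX)
  have heq := X11b.intSeries_constantCoeff_eq_of_isBDPLFunctionInt_of_continuousValues hp2 hK hκ hγ
    hΩK₀ hΩK' hΩp₀ hΩp0' hcont hc0 hQ
  have h2Q : R1.BDPValueAtOneIntAt W p (embAt K p 𝔭 h𝔭 he hf) P Q (W.LFunction p) := by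
    refine ⟨u₀, hu₀, ?_⟩
    rw [X11b.R1.logOmega_eq_padicLogOmega, ← heq]
    exact X11b.R1.intSeries_hasValueAt_zero p Q
  -- the composite and CTL-split at `(𝔭̄, embAt 𝔭̄)`, shadow links there, the index-identity road
  have hIW := LogSymmetry.imcWaldspurgerOnTreeAt_other_of_intHalves_of_splitControl W p hGZK hnf
    ⟨hr, hp2, hred, hmult⟩ hs hCTL hK hHp hLK P hPinf κ hκ γ 𝔭 𝔭bar h𝔭 he hf h𝔭bar hebar hfbar Q h3Q
    h2Q
  have hCTLd : ControlOnTreeAt p κ 𝔭bar γ (embAt K p 𝔭bar h𝔭bar hebar hfbar) P :=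
    hCTL K P ⟨hr, hp2, hred, hmult⟩ hs hK hHp hLK hPinf κ hκ γ 𝔭bar h𝔭bar hebar hfbar
  obtain ⟨S, hIMC, hBDP, hCTL', hTAM⟩ :=
    exists_shadowLinks_of_onTree_of_heegner p κ 𝔭bar γ (embAt K p 𝔭bar h𝔭bar hebar hfbar) rfl hHN hIW
      hCTLd
  exact bsdp_of_cellC_of_indexIdentityAt W p (W.conductorNorm ℤ) K Dt H w₀.embedding P (hGZ _ W K)
    (hKo _ W K) hGZK hmod ⟨hr, hp2, hred, hmult⟩ hK hlt hHN hP hcM hLK Wd Cd hWd htw htam hu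
    (fun hfin => by
      haveI := hfin
      exact indexIdentityAt_of_shadowLinks p S hIMC hBDP hCTL' hTAM htamK)

end Summit.BirchSwinnertonDyer.BirchSwinnertonDyer.Theorems.Reoriented

end
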